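import Summits.HubbardSuperconductivity.HubbardSuperconductivity.Theses.ParityLeeYang
import Literature.MathematicalPhysics.QuantumLattice.ComplexSourcePartitionFn
import Literature.MathematicalPhysics.QuantumLattice.HubbardGaugeBound

/-!
# Birth skeleton (BC3) for the crux `ParityLeeYang.ParityPositiveWindow`
(item stmt-HubbardSuperconductivity-8381; route route-HubbardSuperconductivity-ParityLeeYang, crux of rank 2) —
skeleton registrar planner-skel-stmt-HubbardSuperconductivity-8381-0, 2026-08-17. Published as
`Cruxes/ParityPositiveWindow/Lines/birth.lean`.

The crux (`Summit.HubbardSuperconductivity.HubbardSuperconductivity.Theses.ParityLeeYang.ParityPositiveWindow`):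
some `U > 0`, a hole-doping window `0 < δ₁ < δ₂ < 2/5`, a `μ`-window `[μ₁, μ₂]` and `β₀ > 0` such that for
every `β ≥ β₀`, eventually in the EVEN torus side `L`: (D) the Gibbs density of `hubbardTorusWith 2 L 1 U μ₁`
is `≤ (1-δ₂)L²` and that of `… μ₂` is `≥ (1-δ₁)L²` (the window is swept, compressibly), and (P) the
parity-twisted partition function `Z_P(β,U,μ,L) = Re Tr[(-1)^N e^{-β(H_L-μN)}]` is `> 0` for every
`μ ∈ [μ₁, μ₂]` (no odd Lee–Yang zero on the negative fugacity axis over the window; `L → ∞` at fixed `T`).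

## The seam: reach the parity point along the IMAGINARY ZEEMAN axis (spin Roberge–Weiss segment)

On Fock space `N = N_↑ + N_↓ ≡ N_↑ - N_↓ = 2S^z (mod 2)`, so the parity twist is ALSO a spin rotation by
`2π`: `(-1)^N = e^{iπ·2S^z}`.  Since `[H_L - μN, S^z] = 0` (tree: `commute_hamiltonianWith_spinVecF_holds`),
`Z_P = Tr e^{-β(H_L - μN) + iπ·2S^z} = Z_L(β,U,μ; h = iπ/β)`, the grand-canonical partition function in the
purely IMAGINARY Zeeman field `h = iπT` coupled to `2S^z` — the sourced partition function
`Matrix.partitionFn β (H - h • Q)` of `ComplexSourcePartitionFn` with `Q = 2S^z`, an ENTIRE function of `h`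
(`differentiable_partitionFn_sub_smul`).  Along the segment `h = iy`, `y ∈ [0, πT]`:
`Z_L(iy) = Σ_m Y_L(m) cos(βym)` over the `2S^z = m` sector weights `Y_L(m) = Y_L(-m) ≥ 0` is REAL (spin flip
`e^{iπS^x}` fixes `H_L - μN` and reverses `S^z`; `partitionFn_sub_neg_smul_eq` + Schwarz reflection), equals
`Z > 0` at `y = 0` and `Z_P` at `y = πT`.  Hence:

  ZERO-FREENESS of `y ↦ Z_L(β,U,μ;iy)` on `[0, πT]`  ⟹  `Z_P > 0`   (intermediate value theorem),

which is the classical Lee–Yang logic (sign at a reference point + a zero-free path), with the reference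
point `h = 0` where the sign is free.  WHY THE SPIN PATH and not the route's Roberge–Weiss `μ`-path
`Z_L(β, μ + iθ/β)`, `θ ∈ [0, π]` (same endpoint): the `μ`-path is COMPLEX (phase `e^{iθN̄}`), so zero-freeness
along it decides nothing, and its modulus must cross from the charge branch `e^{-θ²κTL²/2}` to the spin
branch before `θ = π` whenever the crux holds — zeros sit next to that path.  The Zeeman path is real, and on
the ATTRACTIVE side it is sign-definite on the WHOLE axis: Fröhlich–Israel–Lieb–Simon Thm 2.1 with the complex
twist `F = e^{iβy·n}` (`F̄ ⊗ F ↦ e^{-iβy·2S^z}` under `spinSplitHom`) gives `Z_L(iy) ≥ 0` for all real `y`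
when `U ≤ 0` — the one-parameter extension of the landed support `AttractiveParityNonneg` (`y = πT`).  In the
two-branch heuristic `⟨e^{iθN + iφ·2S^z}⟩ ≈ Σ_images exp(-½κTL²(θ-θ_j)² - 2χ_sTL²(φ-φ_j)² + i(θ-θ_j)N̄)`
(image lattice generated by `(2π,0)`, `(0,2π)`, `(π,π)`), the segment `θ = 0`, `φ ∈ [0,π]` is zero-free iff
the spin branch `e^{-2φ²χ_sTL²}` still dominates the charge images `2cos(πN̄)e^{-π²κTL²/2}e^{-2(π-φ)²χ_sTL²}`
at `φ = π`, i.e. iff `4χ_s(T) < κ(T)`: the crux's own heuristic ("spin-fluctuation rate `2π²χ_sT` below the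
charge rate `π²κT/2`"; free fermions: `4χ_s = κ`, the Kramers-double boundary; a spin gap with `κ > 0` wins at
low `T`; Stoner/Nagaoka enhancement loses with sign `cos(πN̄_L(μ))` oscillating in `L`).

* `stub_spinZeroFreeWindow` (E — the residue; open, size XL).  ∃ `U > 0`, `0 < δ₁ < δ₂ < 2/5`, `μ₁ < μ₂`,
  `β₀ > 0`: ∀ `β ≥ β₀`, eventually in even `L`: the density clauses (D) VERBATIM and, for every
  `μ ∈ [μ₁, μ₂]` and every `y ∈ [0, π/β]`, `Z_L(β,U,μ; iy) ≠ 0` — a COMPRESSIBLE window on which the complex-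
  ZEEMAN-field Lee–Yang zeros of the repulsive Hubbard torus avoid the imaginary segment `[0, iπT]`.  A
  non-vanishing statement (what convergent expansions / Lee–Yang-type theorems deliver: `log Z_L(h)` analytic
  up to the spin Roberge–Weiss point), not a sign.  Why it might fail = the crux's (the pure `t'=0` model may
  own no spin-gapped compressible window: stripes at `U ≈ 6–8`, `δ ≈ 1/8`; `e^{-c/U²}` scales at weak `U`)
  plus: an interior zero on the segment from a third branch even where `Z_P > 0`.
* `stub_imaginaryZeemanParity` (R — kinematics of the dictionary; TRUE, size M).  For `β > 0` and all
  `U, μ, L`: `Z_L(β,U,μ; iπ/β) = Tr[parityOp · e^{-β(H_L-μN)}]` (`parityOp = diagonal (-1)^{#s}`,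
  `2S^z = diagonal (#up s - #down s)` by `LiebThm1.spinZ_eq_diagonal`, `#s ≡ #up - #down (mod 2)`,
  `e^{A+B} = e^A e^B` for the commuting `A = -βK`, `B = iπ·2S^z`), and `Im Z_L(β,U,μ; iy) = 0` for every real
  `y` (evenness in `h` from the spin flip `W = e^{iπS^x}`, `W K W⁻¹ = K`, `W S^z W⁻¹ = -S^z`, via
  `partitionFn_sub_neg_smul_eq`; conjugation symmetry `conj Z_L(h) = Z_L(conj h)` from `Kᴴ = K`, `(S^z)ᴴ = S^z`).

`ParityPositiveWindow_of : Sig.stub_spinZeroFreeWindow → Sig.stub_imaginaryZeemanParity → ParityPositiveWindow`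
concludes the route decl BY NAME and is proved sorry-free here: continuity of `y ↦ Z_L(iy)` from entire-ness
(`differentiable_partitionFn_sub_smul`), `Re Z_L(0) = Z > 0` (`Matrix.partitionFn_pos`,
`isHermitian_hamiltonianWith`), the intermediate value theorem on `[0, π/β]` (`intermediate_value_Icc'`)
against realness (R) and zero-freeness (E), then the endpoint identity (R).  `ParityPositiveWindow_proof` is
the skeleton in its final shape (depends on `sorryAx` through the two stubs only).

## Disproof used / dead lines / negatives

`ledger crux ls stmt-HubbardSuperconductivity-8381`: no workfiles at registration (no `Disproof.lean`, no
dead lines, no crux ideas).  `ledger negatives --problem HubbardSuperconductivity`: no refuted statement equal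
or trivially equivalent to either stub (checked 2026-08-17, list in the seat's NOTES.md).  Route supports
already landed and consistent with the seam: `AttractiveParityNonneg` (U ≤ 0: `Z_P ≥ 0`, the `y = πT` case
of the spin-twist reflection positivity above), `FreeParityDet` (U = 0: `Z_P = det(1-e^{-βh})² ≥ 0`, double
zeros ON the segment's endpoint — E fails at `U = 0`, as it must), `BandBottomOnAxis` (sign changes near the
band bottom: E is a WINDOW statement away from it).

## BC3 audit (this seat; raw outputs in the seat's NOTES.md `birth-certificate:`)

`lean check --json` rc 0 with `sorry` exactly in `stub_spinZeroFreeWindow`, `stub_imaginaryZeemanParity`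
(sorry count 2 = stub count, zero elsewhere); probes `stub → ParityPositiveWindow` and
`stub → HubbardSuperconductivity` by `first | exact? | simpa [stub] | (unfold stub; simpa) | aesop` FAIL for
both stubs (4/4), files `bc/probe_*.lean` of the seat folder.
-/

set_option linter.dupNamespace false

noncomputable section

namespace Summit.HubbardSuperconductivity.HubbardSuperconductivity.Cruxes.ParityPositiveWindow.Birth

open Matrix Complex
open Literature.MathematicalPhysics.QuantumLattice
open Summit.HubbardSuperconductivity.HubbardSuperconductivity.Theses.ParityLeeYang
open scoped ComplexOrder Matrix.Norms.L2Operator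

/-! ### Vocabulary of the seam (bodies over existing declarations only) -/

/-- Twice the total spin, `2S^z = N_↑ - N_↓`, on the Fock space of the torus of side `L`
(`HubbardWave0.spinZ = ½ Σ_x (n_{x↑} - n_{x↓})`). -/
def twoSz (L : ℕ) : Matrix (Finset (Orb (FermionTorus 2 L))) (Finset (Orb (FermionTorus 2 L))) ℂ :=
  (2 : ℂ) • (HubbardWave0.spinZ : Matrix (Finset (Orb (FermionTorus 2 L))) (Finset (Orb (FermionTorus 2 L))) ℂ)

/-- The grand-canonical partition function of the pure Hubbard torus (`t = 1`) in a COMPLEX Zeeman field `h`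
coupled to `2S^z`: `Z_L(β,U,μ;h) = tr e^{-β(H_L - μN - h·2S^z)}` — the sourced partition function
`Matrix.partitionFn β (H - h • Q)` of `ComplexSourcePartitionFn` with `H = hubbardTorusWith 2 L 1 U μ`,
`Q = 2S^z`.  Real `h` = a Zeeman field; `h = iy` = the imaginary (spin Roberge–Weiss) axis; `h = iπ/β` = the
parity point. -/
def zeemanPF (β U μ : ℝ) (L : ℕ) (h : ℂ) : ℂ :=
  Matrix.partitionFn β (hubbardTorusWith 2 L 1 U μ - h • twoSz L)

/-! ### Stub signatures (`Sig.stub_*`: the hypothesis heads of `ParityPositiveWindow_of` carry the registered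
stub names) -/

/-- STUB E — A COMPRESSIBLE SPIN-LEE–YANG-ZERO-FREE WINDOW OF THE PURE REPULSIVE MODEL EXISTS (the residue;
open, size XL).  Some `U > 0`, `0 < δ₁ < δ₂ < 2/5`, `μ₁ < μ₂`, `β₀ > 0` such that for every `β ≥ β₀`,
eventually in even `L`: the two density clauses of the crux verbatim (Gibbs density `≤ (1-δ₂)L²` at `μ₁`,
`≥ (1-δ₁)L²` at `μ₂`) and, for every `μ ∈ [μ₁, μ₂]` and every `y ∈ [0, π/β]`, the complex-Zeeman-field
partition function does not vanish at `h = iy`: the Lee–Yang zeros in the complex ZEEMAN field stay off the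
imaginary segment `[0, iπT]` (spin channel dominates the parity point: heuristically `4χ_s(T) < κ(T)`).
Why it might fail: the pure `t' = 0` model may own no spin-gapped compressible doping window at all (filled
stripes at `U ≈ 6–8`, `δ ≈ 1/8`; pairing scales `e^{-c/U²}` at weak `U`), and a third large-deviation branch
could put an interior zero on the segment even where `Z_P > 0`.  Sources: ArovasBergKivelsonRaghu2022 §9,
QinEtAl2020, RobergeWeiss1986, LeeYang1952, JankoSmithAmbegaokar1994, MatveevLarkin1997. -/
def Sig.stub_spinZeroFreeWindow : Prop :=
  ∃ U : ℝ, 0 < U ∧ ∃ δ₁ δ₂ : ℝ, 0 < δ₁ ∧ δ₁ < δ₂ ∧ δ₂ < 2 / 5 ∧ ∃ μ₁ μ₂ : ℝ, μ₁ < μ₂ ∧ ∃ β₀ : ℝ, 0 < β₀ ∧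
    ∀ β : ℝ, β₀ ≤ β → ∃ L₀ : ℕ, ∀ L : ℕ, Even L → L₀ ≤ L →
      ((hubbardTorusWith 2 L 1 U μ₁).gibbsState β totalNumber).re ≤ (1 - δ₂) * (L : ℝ) ^ 2 ∧
      (1 - δ₁) * (L : ℝ) ^ 2 ≤ ((hubbardTorusWith 2 L 1 U μ₂).gibbsState β totalNumber).re ∧
      ∀ μ ∈ Set.Icc μ₁ μ₂, ∀ y ∈ Set.Icc (0 : ℝ) (Real.pi / β), zeemanPF β U μ L ((y : ℂ) * Complex.I) ≠ 0

/-- STUB R — THE IMAGINARY-ZEEMAN (SPIN ROBERGE–WEISS) REPRESENTATION OF THE PARITY TWIST (kinematics of the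
dictionary; TRUE, size M).  For every `β > 0`, `U`, `μ`, `L`: (i) the parity-twisted trace is the endpoint of
the imaginary Zeeman segment, `Z_L(β,U,μ; iπ/β) = Tr[parityOp · e^{-β(H_L - μN)}]` — `(-1)^N = e^{iπ·2S^z}`
on Fock space (`N ≡ 2S^z (mod 2)`; `parityOp`, `2S^z` diagonal in the occupation basis,
`LiebThm1.spinZ_eq_diagonal`) and `e^{-βK + iπ·2S^z} = e^{-βK} e^{iπ·2S^z}` since `[K, S^z] = 0`
(`commute_hamiltonianWith_spinVecF_holds`, Mathlib `Matrix.exp_add_of_commute`); (ii) `Z_L(β,U,μ; iy)` is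
REAL for every real `y` — even in `h` by the spin flip `W = e^{iπS^x}` (`W K W⁻¹ = K`, `W S^z W⁻¹ = -S^z`,
`partitionFn_sub_neg_smul_eq`) and `conj Z_L(h) = Z_L(conj h)` (`Kᴴ = K`, `(S^z)ᴴ = S^z`,
`HubbardWave0.spinZ_isHermitian`, `isHermitian_hamiltonianWith`).  Sources: RobergeWeiss1986 (imaginary
chemical potential ↔ centre twist), Tasaki2020 §9.3.2 (spin rotation symmetry of the Hubbard model), folklore. -/
def Sig.stub_imaginaryZeemanParity : Prop :=
  ∀ (β U μ : ℝ) (L : ℕ), 0 < β →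
    zeemanPF β U μ L (((Real.pi / β : ℝ) : ℂ) * Complex.I) =
        (parityOp * (hubbardTorusWith 2 L 1 U μ).gibbsWeight β).trace ∧
      ∀ y : ℝ, (zeemanPF β U μ L ((y : ℂ) * Complex.I)).im = 0

/-! ### Registered stubs -/

/-- Registered stub E (existence of the compressible spin-zero-free window — the residue; load-bearing,
hardest). -/
theorem stub_spinZeroFreeWindow : Sig.stub_spinZeroFreeWindow := by
  sorry

/-- Registered stub R (imaginary-Zeeman representation of the parity twist: endpoint identity + realness on
the imaginary axis — kinematic, provable now). -/
theorem stub_imaginaryZeemanParity : Sig.stub_imaginaryZeemanParity := by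
  sorry

/-! ### Sorry-free glue -/

/-- **Lee–Yang logic on a segment.** A continuous complex function on `[a, b]` that is real there, has
positive real part at `a` and no zero on `[a, b]` has positive real part at `b` (intermediate value theorem for
`Re f`: a sign change would produce a zero). [folklore] -/
theorem re_endpoint_pos_of_zeroFree {f : ℝ → ℂ} {a b : ℝ} (hab : a ≤ b)
    (hcont : ContinuousOn f (Set.Icc a b)) (hreal : ∀ y ∈ Set.Icc a b, (f y).im = 0)
    (h0 : 0 < (f a).re) (hzf : ∀ y ∈ Set.Icc a b, f y ≠ 0) : 0 < (f b).re := by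
  by_contra hle
  have hle' : (f b).re ≤ 0 := not_lt.mp hle
  have hc : ContinuousOn (fun y => (f y).re) (Set.Icc a b) :=
    Complex.continuous_re.comp_continuousOn hcont
  obtain ⟨y, hy, hy0⟩ : ∃ y ∈ Set.Icc a b, (f y).re = 0 :=
    intermediate_value_Icc' hab hc ⟨hle', h0.le⟩
  exact hzf y hy (Complex.ext (by simpa using hy0) (by simpa using hreal y hy))

/-- `y ↦ Z_L(β,U,μ; iy)` is continuous (the sourced partition function is entire in the complex source,
`differentiable_partitionFn_sub_smul`). [folklore] -/
theorem continuous_zeemanPF_imaginary (β U μ : ℝ) (L : ℕ) :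
    Continuous fun y : ℝ => zeemanPF β U μ L ((y : ℂ) * Complex.I) := by
  have hd := (differentiable_partitionFn_sub_smul β (hubbardTorusWith 2 L 1 U μ) (twoSz L)).continuous
  exact hd.comp (Complex.continuous_ofReal.mul continuous_const)

/-- At zero field the Zeeman partition function is the partition function of the Hermitian grand-canonical
Hubbard torus, whose real part is positive (`Matrix.partitionFn_pos`). [folklore] -/
theorem zeemanPF_zero_re_pos (β U μ : ℝ) (L : ℕ) :
    0 < (zeemanPF β U μ L (((0 : ℝ) : ℂ) * Complex.I)).re := by
  have hZ : zeemanPF β U μ L (((0 : ℝ) : ℂ) * Complex.I) = Matrix.partitionFn β (hubbardTorusWith 2 L 1 U μ) := by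
    simp [zeemanPF]
  have hH : (hubbardTorusWith 2 L 1 U μ).IsHermitian := isHermitian_hamiltonianWith (fermionTorusGraph 2 L) 1 U μ
  rw [hZ]
  exact (Complex.pos_iff.mp (Matrix.partitionFn_pos β hH)).1

/-! ### Composition -/

/-- **The line closes the crux BY NAME modulo the two registered stubs.**  E supplies the window
`(U, δ₁, δ₂, μ₁, μ₂, β₀)` with the density clauses and, at every admissible `(β, L, μ)`, zero-freeness of
`y ↦ Z_L(β,U,μ;iy)` on `[0, π/β]`; R makes that function real and identifies its value at `y = π/β` with the
parity-twisted trace; continuity (entire in the source), `Re Z_L(0) = Z > 0` and the intermediate value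
theorem (`re_endpoint_pos_of_zeroFree`) give `Z_P > 0`. -/
theorem ParityPositiveWindow_of :
    Sig.stub_spinZeroFreeWindow → Sig.stub_imaginaryZeemanParity → ParityPositiveWindow := by
  rintro ⟨U, hU, δ₁, δ₂, hδ₁, hδ₁₂, hδ₂, μ₁, μ₂, hμ, β₀, hβ₀, hW⟩ hR
  refine ⟨U, hU, δ₁, δ₂, hδ₁, hδ₁₂, hδ₂, μ₁, μ₂, hμ, β₀, hβ₀, fun β hβ => ?_⟩
  obtain ⟨L₀, hL⟩ := hW β hβ
  refine ⟨L₀, fun L hev hL₀ => ?_⟩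
  obtain ⟨hlo, hhi, hzf⟩ := hL L hev hL₀
  refine ⟨hlo, hhi, fun μ hμI => ?_⟩
  have hβpos : 0 < β := lt_of_lt_of_le hβ₀ hβ
  obtain ⟨hend, hreal⟩ := hR β U μ L hβpos
  have hπβ : (0 : ℝ) ≤ Real.pi / β := div_nonneg Real.pi_pos.le hβpos.le
  have key : 0 < (zeemanPF β U μ L (((Real.pi / β : ℝ) : ℂ) * Complex.I)).re :=
    re_endpoint_pos_of_zeroFree (f := fun y : ℝ => zeemanPF β U μ L ((y : ℂ) * Complex.I)) hπβ
      (continuous_zeemanPF_imaginary β U μ L).continuousOn (fun y _ => hreal y)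
      (zeemanPF_zero_re_pos β U μ L) (hzf μ hμI)
  rwa [hend] at key

/-- The skeleton in its final shape (D-0027 §3.3): the crux BY NAME from the two registered stubs; it becomes
the crux proof when the last `stub_*` is discharged (until then it depends on `sorryAx` through the stubs
only — no `sorry` of its own). -/
theorem ParityPositiveWindow_proof : ParityPositiveWindow :=
  ParityPositiveWindow_of stub_spinZeroFreeWindow stub_imaginaryZeemanParity

end Summit.HubbardSuperconductivity.HubbardSuperconductivity.Cruxes.ParityPositiveWindow.Birth

end
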